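import Summits.HodgeConjecture.HodgeConjecture.Theorems.R90S6TwistedKappaHDetects         -- ★ K5: `mem_HTildePoints_of_commute`, `detZero_ne_zero_of_mem_HTildePoints`, HEAD kernel criterion; brings ★ K3, ★ Ch3 §3.13 vocabulary
import Summits.HodgeConjecture.HodgeConjecture.Theorems.R90S6TwistedKappaClassFunction    -- ★ K4: `det_coe_qsInvolution` (`det Θ_σ(g) = (σ det g)⁻¹`)
import Summits.HodgeConjecture.HodgeConjecture.Theorems.R90S6LatticeInvPolarity           -- ★ `qsInvolution_one`, `qsInvolution_inv`; brings ★ `UnitaryGroup.coe_qsInvolution_apply`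
import Literature.NumberTheory.Automorphic.OrbitalMeasureFamilyRegular                    -- ★ `Literature.LinearAlgebra.Matrix.commute_of_charpoly_separable` (commutant of a regular matrix)
import HarnessLib

/-!
# R90 · S6 «Ch. 14.1–14.5 stable trace formula» — card K6: `κ̃` ON THE COMMUTING ε-COCYCLES IS A CHARACTER, TRIVIAL ON `F^×` AND ON
# ε-COBOUNDARIES (`Theorems/R90S6TwistedKappaCocycleCharacter.lean`)

Rows E1.4.4.2.4 («constancy of `κ̃` on `T`-orbits ∕ `κ̃` as a character of `𝔇 ≅ (ℤ∕2)^r`») + E1.3.5.2.2 (κ-bookkeeping); consumer E1.4.4.3.1.  Dealer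
R90-C14-plan (g2), card K6 2026-09-05T01:54:02Z.  FRAME = ★ K5 (`Theorems/R90S6TwistedKappaHDetects`): `Θ_σ = UnitaryGroup.qsInvolution σ`,
`H̃ = HTildePoints` (centraliser of `γ₀ = d(1,−1,1)`), `det₀ = detZero`, `F^× ⊂ Z̃` = ★ `fixedScalarSubgroup σ`, and the sign
`κ̃(x) = (ord_w x).negOnePow = (WithZero.log (Valued.v x)).negOnePow` of ★ K3 ∕ ★ L4 (written out; no definition).  The point of the card
([Rogawski1990] §3.11 p. 35, §3.13 p. 38, §4.10 p. 57): on the commuting cocycles `α ∈ T̃ = Z(γ)` (`α Θ_σ(α) = 1`) the sign `κ̃(det₀ α)` is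
MULTIPLICATIVE, kills the `F^×`-scalars and the ε-coboundaries `h Θ_σ(h)⁻¹` (`h ∈ H̃`), hence is a CLASS FUNCTION on
`𝔇 = cocycles ∕ (F^× · coboundaries)`; its KERNEL is the `H`-image (★ K5 HEAD `negOnePow_log_detZero_eq_one_iff_qsInvolution`, cited, not restated).

* §1 ALGEBRA over any field `E` with a ring endomorphism `τ` (no valuation):
  `commute_of_commute_of_isRegular` (two elements commuting with a REGULAR `γ` commute — ★ `commute_of_charpoly_separable`);
  `mul_qsInvolution_mul_eq_one` ∕ `inv_mul_qsInvolution_inv_eq_one` (commuting cocycles are closed under `·` and `⁻¹`);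
  **`detZero_mul_of_mem_HTildePoints`** (`det₀(αβ) = det₀ α · det₀ β` as soon as the LEFT factor lies in `H̃`, char `≠ 2`);
  **`detZero_inv_qsInvolution`** (`det₀((Θ_σ h)⁻¹) = τ(det₀ h)` for EVERY `h` — ★ K4 `det_coe_qsInvolution` and `rev 1 = 1` in `Fin 3`);
  `detZero_mul_of_mem_fixedScalarSubgroup` (`det₀(z·α) = c²·det₀ α` for `z = c·1 ∈ F^×`); `detZero_eq_norm_mul_detZero_of_rel` (from `z·α = h·β·Θ_σ(h)⁻¹`,
  `h ∈ H̃`: `det₀ α = w·τ(w)·det₀ β` with `w = c⁻¹·det₀ h ≠ 0`); `isNormFromE_norm_mul_iff` (norms are a group) and the `IsNormFromE` twin of the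
  HEAD, `isNormFromE_detZero_iff_of_rel`.
* §2 SIGNS in ★ K3's `Valued K ℤᵐ⁰` frame: `negOnePow_log_mul_of_ne_zero` (`κ̃` multiplicative on `K^×`), `negOnePow_log_mul_mul_of_valuation_eq`
  (`κ̃(a·b·x) = κ̃(x)` when `v a = v b` — squares and norms die); **`negOnePow_log_detZero_mul`** (K6.2), **`negOnePow_log_detZero_mul_inv_qsInvolution`**
  (K6.3: `κ̃(det₀(h·Θ_σ(h)⁻¹)) = 1`, `h ∈ H̃`), **`negOnePow_log_detZero_fixedScalar_mul`** (K6.4: `κ̃(det₀(z·α)) = κ̃(det₀ α)`), and the HEAD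
  **`negOnePow_log_detZero_eq_of_rel`** (K6.5: `z·α = h·β·Θ_σ(h)⁻¹`, `z ∈ F^×`, `h, β ∈ H̃` ⇒ `κ̃(det₀ α) = κ̃(det₀ β)`) — no `γ`, no cocycle
  hypothesis and no `Commute h γ` are needed for the class-function statement (they were idle); consumers get `β ∈ H̃` from ★ K5
  `mem_HTildePoints_of_commute`.

Lane `--kind proof --supports stmt-HodgeConjecture-24833 --as helper`; THEOREMS ONLY (no definition, no instance, no notation, no named fact, no `sorry`);
pure algebra + valuation parity.  Seat R90-C14-p08 (g0).
HONEST LABEL: sign-layer bookkeeping, count-neutral until E1.4.4.2.4 ∕ E1.4.4.3.1 consume it; HC_CM is proved only modulo the 7 printed citations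
(2 remaining named inputs: hLiu418 = stmt-HodgeConjecture-24832, h413 = stmt-HodgeConjecture-24833) until rung 0 closes.

## References
* [Rogawski1990] J. D. Rogawski, *Automorphic Representations of Unitary Groups in Three Variables*, Ann. of Math. Stud. 123 (1990): §3.11 p. 35
  (`𝒟_ε(δ∕F)`, cocycles `t_ν`, the `F^× ∕ NE^×` ambiguity), §3.13 Prop. 3.13.1 p. 38, §4.10 p. 57 (`μ(det₀ δ)`), §3.1 p. 19 (regular elements).
* [Serre1979] J.-P. Serre, *Local Fields* (1979): Ch. V §2 (norms at an unramified place) — through ★ K3.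
-/

set_option autoImplicit false
-- the mandated namespace repeats the single-problem summit's segment (`HodgeConjecture.HodgeConjecture`)
set_option linter.dupNamespace false

noncomputable section

open scoped Matrix MatrixGroups Valued WithZero
open Literature.NumberTheory.Automorphic
open Literature.NumberTheory.Rogawski1990.Ch3Sec10to13
open Literature.NumberTheory.Rogawski1990.Ch4Sec10 (fixedScalarSubgroup)

namespace Summit.HodgeConjecture.HodgeConjecture.R90.S6

/-! ## §1 Algebra: closure of the commuting cocycles; `det₀` on `H̃`, on `Θ_σ(h)⁻¹`, on scalars; the norm relation -/

section Algebra

variable {E : Type} [Field E] (τ : E →+* E)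

/-- **K6 §1 — TWO ELEMENTS COMMUTING WITH A REGULAR `γ` COMMUTE** (`T̃ = Z(γ)` is commutative): ★ `IsRegular` = separable characteristic
polynomial, so the commutant of `γ` is `E[γ]` (★ `Literature.LinearAlgebra.Matrix.commute_of_charpoly_separable`). [cite: Rogawski1990, §3.1 p. 19] -/
theorem commute_of_commute_of_isRegular {n : ℕ} {γ α β : GL (Fin n) E}
    (hreg : Literature.NumberTheory.Rogawski1990.Ch3Sec10to13.IsRegular E γ) (hα : Commute α γ) (hβ : Commute β γ) : Commute α β := by
  have hc : ∀ {δ : GL (Fin n) E}, Commute δ γ → Commute ((γ : GL (Fin n) E) : Matrix (Fin n) (Fin n) E) (δ : Matrix (Fin n) (Fin n) E) :=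
    fun {δ} hδ => by
      have := congrArg (fun u : GL (Fin n) E => (u : Matrix (Fin n) (Fin n) E)) hδ.eq
      simp only [Units.val_mul] at this
      change _ * _ = _ * _
      exact this.symm
  have key := (Literature.LinearAlgebra.Matrix.commute_of_charpoly_separable _ hreg (hc hα) (hc hβ)).eq
  refine Units.ext ?_
  rw [Units.val_mul, Units.val_mul]
  exact key

/-- **K6 §1 — COMMUTING COCYCLES ARE CLOSED UNDER PRODUCT**: if `αβ = βα`, `α Θ_σ(α) = 1`, `β Θ_σ(β) = 1` then `(αβ) Θ_σ(αβ) = 1` (`Θ_σ` multiplicative,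
★ `qsInvolution_mul`; `Θ_σ(α) = α⁻¹`).  (Commuting with `γ` is closed under `·`, `⁻¹` by Mathlib `Commute.mul_left`, `Commute.inv_left`.)
[cite: Rogawski1990, §3.11 p. 35] -/
theorem mul_qsInvolution_mul_eq_one {N : ℕ} {α β : GL (Fin N) E} (hαβ : Commute α β)
    (hα : α * UnitaryGroup.qsInvolution τ α = 1) (hβ : β * UnitaryGroup.qsInvolution τ β = 1) :
    α * β * UnitaryGroup.qsInvolution τ (α * β) = 1 := by
  rw [UnitaryGroup.qsInvolution_mul, eq_inv_of_mul_eq_one_right hα, eq_inv_of_mul_eq_one_right hβ, hαβ.eq, mul_assoc,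
    ← mul_assoc α, mul_inv_cancel, one_mul, mul_inv_cancel]

/-- **K6 §1 — AND UNDER INVERSE**: `α Θ_σ(α) = 1 ⇒ α⁻¹ Θ_σ(α⁻¹) = 1` (★ `qsInvolution_inv`). [cite: Rogawski1990, §3.11 p. 35] -/
theorem inv_mul_qsInvolution_inv_eq_one {N : ℕ} {α : GL (Fin N) E} (hα : α * UnitaryGroup.qsInvolution τ α = 1) :
    α⁻¹ * UnitaryGroup.qsInvolution τ α⁻¹ = 1 := by
  rw [qsInvolution_inv, eq_inv_of_mul_eq_one_right hα, inv_inv, inv_mul_cancel]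

/-- A matrix commuting with `γ₀ = d(1,−1,1)` has vanishing row-`1` off-block entries (char `≠ 2`). [folklore] -/
private theorem row_one_offblock_eq_zero (h2 : (2 : E) ≠ 0) {M : Matrix (Fin 3) (Fin 3) E}
    (h : M * gammaZero E = gammaZero E * M) : M 1 0 = 0 ∧ M 1 2 = 0 := by
  have h10 := congrFun (congrFun h 1) 0; have h12 := congrFun (congrFun h 1) 2
  simp [gammaZero, Matrix.mul_apply, Matrix.diagonal] at h10 h12
  refine ⟨(mul_eq_zero.1 (?_ : (2 : E) * M 1 0 = 0)).resolve_left h2, (mul_eq_zero.1 (?_ : (2 : E) * M 1 2 = 0)).resolve_left h2⟩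
  · linear_combination h10
  · linear_combination h12

/-- **K6 §1 — `det₀` IS MULTIPLICATIVE AS SOON AS THE LEFT FACTOR LIES IN `H̃`**: `det₀(αβ) = det₀ α · det₀ β` for `α ∈ H̃`, any `β` (char `≠ 2`):
`det` is multiplicative and `(αβ)₁₁ = α₁₁ β₁₁` because row `1` of `α` is `(0, α₁₁, 0)`. [cite: Rogawski1990, §3.13 p. 38; §4.10 p. 57] -/
theorem detZero_mul_of_mem_HTildePoints (h2 : (2 : E) ≠ 0) {α : GL (Fin 3) E} (hα : α ∈ HTildePoints E) (β : GL (Fin 3) E) :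
    detZero E (α * β) = detZero E α * detZero E β := by
  obtain ⟨a10, a12⟩ := row_one_offblock_eq_zero h2 hα
  have h11 : ((α * β : GL (Fin 3) E) : Matrix (Fin 3) (Fin 3) E) 1 1 =
      ((α : GL (Fin 3) E) : Matrix (Fin 3) (Fin 3) E) 1 1 * ((β : GL (Fin 3) E) : Matrix (Fin 3) (Fin 3) E) 1 1 := by
    rw [Units.val_mul, Matrix.mul_apply, Fin.sum_univ_three, a10, a12, zero_mul, zero_mul, zero_add, add_zero]
  unfold detZero
  rw [map_mul, Units.val_mul, h11, mul_inv]
  ring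

/-- **K6 §1 — `det₀((Θ_σ h)⁻¹) = τ(det₀ h)` FOR EVERY `h ∈ GL₃(E)`**: `det (Θ_σ h)⁻¹ = τ(det h)` (★ K4 `det_coe_qsInvolution`) and
`((Θ_σ h)⁻¹)₁₁ = Θ_σ(h⁻¹)₁₁ = τ(h₁₁)` (★ `UnitaryGroup.coe_qsInvolution_apply`, `rev 1 = 1` in `Fin 3`). [cite: Rogawski1990, §3.10 p. 33; §3.13 p. 38] -/
theorem detZero_inv_qsInvolution (h : GL (Fin 3) E) : detZero E (UnitaryGroup.qsInvolution τ h)⁻¹ = τ (detZero E h) := by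
  have hdet : ((Matrix.GeneralLinearGroup.det (UnitaryGroup.qsInvolution τ h)⁻¹ : Eˣ) : E) =
      τ ((Matrix.GeneralLinearGroup.det h : Eˣ) : E) := by
    rw [map_inv, Units.val_inv_eq_inv_val, Matrix.GeneralLinearGroup.val_det_apply, det_coe_qsInvolution, inv_inv,
      Matrix.GeneralLinearGroup.val_det_apply]
  have hrev : (1 : Fin 3).rev = 1 := rfl
  have h11 : (((UnitaryGroup.qsInvolution τ h)⁻¹ : GL (Fin 3) E) : Matrix (Fin 3) (Fin 3) E) 1 1 =
      τ (((h : GL (Fin 3) E) : Matrix (Fin 3) (Fin 3) E) 1 1) := by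
    rw [← qsInvolution_inv, UnitaryGroup.coe_qsInvolution_apply, inv_inv, hrev]
  unfold detZero
  rw [hdet, h11, map_mul, map_inv₀]

/-- An element of `F^× ⊂ Z̃` (★ `fixedScalarSubgroup τ`) is `c · 1` with `τ c = c`, `c ≠ 0`. [cite: Rogawski1990, §3.11 p. 35] -/
private theorem exists_coe_eq_smul_one_of_mem_fixedScalarSubgroup {n : ℕ} {z : GL (Fin n) E} (hz : z ∈ fixedScalarSubgroup τ) :
    ∃ c : E, c ≠ 0 ∧ τ c = c ∧ ((z : GL (Fin n) E) : Matrix (Fin n) (Fin n) E) = c • (1 : Matrix (Fin n) (Fin n) E) := by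
  obtain ⟨c, hc, rfl⟩ := hz
  have hc' : Units.map (τ : E →* E) c = MonoidHom.id Eˣ c := hc
  refine ⟨c, c.ne_zero, by simpa using congrArg Units.val hc', ?_⟩
  show ((Matrix.GeneralLinearGroup.scalar (Fin n) c : GL (Fin n) E) : Matrix (Fin n) (Fin n) E) = (c : E) • (1 : Matrix (Fin n) (Fin n) E)
  rw [Matrix.GeneralLinearGroup.coe_scalar, Matrix.scalar_apply, ← Matrix.smul_one_eq_diagonal]

/-- **K6 §1 — SCALARS: `det₀(z·α) = c²·det₀ α`** for `z = c·1 ∈ F^×` (`det(cα) = c³ det α`, `(cα)₁₁ = c α₁₁`; valid also when `α₁₁ = 0`, both sides `0`).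
[cite: Rogawski1990, §3.11 p. 35; §3.13 p. 38] -/
theorem detZero_mul_of_mem_fixedScalarSubgroup {z : GL (Fin 3) E} (hz : z ∈ fixedScalarSubgroup τ) (α : GL (Fin 3) E) :
    ∃ c : E, c ≠ 0 ∧ τ c = c ∧ detZero E (z * α) = c ^ 2 * detZero E α := by
  obtain ⟨c, hc0, hτc, hz1⟩ := exists_coe_eq_smul_one_of_mem_fixedScalarSubgroup τ hz
  refine ⟨c, hc0, hτc, ?_⟩
  have hM : ((z * α : GL (Fin 3) E) : Matrix (Fin 3) (Fin 3) E) = c • ((α : GL (Fin 3) E) : Matrix (Fin 3) (Fin 3) E) := by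
    rw [Units.val_mul, hz1, Matrix.smul_mul, Matrix.one_mul]
  have key : ∀ D A : E, c ^ 3 * D * (c * A)⁻¹ = c ^ 2 * (D * A⁻¹) := fun D A => by
    rw [mul_inv]
    calc c ^ 3 * D * (c⁻¹ * A⁻¹) = c ^ 2 * (D * A⁻¹) * (c * c⁻¹) := by ring
      _ = c ^ 2 * (D * A⁻¹) := by rw [mul_inv_cancel₀ hc0, mul_one]
  unfold detZero
  rw [Matrix.GeneralLinearGroup.val_det_apply, Matrix.GeneralLinearGroup.val_det_apply, hM, Matrix.det_smul, Fintype.card_fin,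
    Matrix.smul_apply, smul_eq_mul, key]

/-- **K6 §1 — THE RELATION `z·α = h·β·Θ_σ(h)⁻¹` ON `det₀`**: for `z = c·1 ∈ F^×` and `h ∈ H̃` (char `≠ 2`), `det₀ α = w·τ(w)·det₀ β` with
`w = c⁻¹·det₀ h ≠ 0` — `det₀(z·α) = c² det₀ α`, `det₀(h·β·Θ_σ(h)⁻¹) = det₀ h · det₀ β · τ(det₀ h)` (§1 lemmas) and `τ c = c`.
[cite: Rogawski1990, §3.11 p. 35; §3.13 Prop. 3.13.1 p. 38] -/
private theorem detZero_eq_norm_mul_detZero_of_rel (h2 : (2 : E) ≠ 0) {z h α β : GL (Fin 3) E} (hz : z ∈ fixedScalarSubgroup τ)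
    (hh : h ∈ HTildePoints E) (hβ : β ∈ HTildePoints E) (hrel : z * α = h * β * (UnitaryGroup.qsInvolution τ h)⁻¹) :
    ∃ w : E, w ≠ 0 ∧ detZero E α = w * τ w * detZero E β := by
  obtain ⟨c, hc0, hτc, hzα⟩ := detZero_mul_of_mem_fixedScalarSubgroup τ hz α
  have hh0 : detZero E h ≠ 0 := detZero_ne_zero_of_mem_HTildePoints h2 hh
  have hR : detZero E (h * β * (UnitaryGroup.qsInvolution τ h)⁻¹) = detZero E h * (detZero E β * τ (detZero E h)) := by
    rw [mul_assoc h, detZero_mul_of_mem_HTildePoints h2 hh, detZero_mul_of_mem_HTildePoints h2 hβ, detZero_inv_qsInvolution]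
  have e : c ^ 2 * detZero E α = detZero E h * (detZero E β * τ (detZero E h)) := by rw [← hzα, hrel, hR]
  refine ⟨c⁻¹ * detZero E h, mul_ne_zero (inv_ne_zero hc0) hh0, ?_⟩
  rw [eq_inv_mul_iff_mul_eq₀ (pow_ne_zero 2 hc0) |>.2 e, map_mul, map_inv₀, hτc]
  ring

/-- **Norms are a group**: `w·τ(w)·y ∈ NE^× ⟺ y ∈ NE^×` for `w ≠ 0` (★ `Ch3Sec10to13.IsNormFromE`). [cite: Rogawski1990, §3.11 p. 36] -/
private theorem isNormFromE_norm_mul_iff {F : Type} [Field F] [Algebra F E] (σ : E ≃ₐ[F] E) {w : E} (hw : w ≠ 0) (y : E) :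
    IsNormFromE F E σ (w * σ w * y) ↔ IsNormFromE F E σ y := by
  refine ⟨fun ⟨u, hu, hxy⟩ => ⟨u * w⁻¹, mul_ne_zero hu (inv_ne_zero hw), ?_⟩, fun ⟨u, hu, hy⟩ => ⟨w * u, mul_ne_zero hw hu, ?_⟩⟩
  · have hσw : σ w ≠ 0 := (map_ne_zero σ).2 hw
    rw [map_mul, map_inv₀]
    calc y = (w * σ w)⁻¹ * (w * σ w * y) := by rw [← mul_assoc, inv_mul_cancel₀ (mul_ne_zero hw hσw), one_mul]
      _ = u * w⁻¹ * (σ u * (σ w)⁻¹) := by rw [hxy, mul_inv]; ring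
  · rw [hy, map_mul]; ring

/-- **K6 HEAD, `IsNormFromE` TWIN — `κ̃` IS A CLASS FUNCTION (norm letters)**: if `z·α = h·β·Θ_σ(h)⁻¹` with `z ∈ F^×`, `h, β ∈ H̃` (char `≠ 2`), then
`det₀ α ∈ NE^× ⟺ det₀ β ∈ NE^×` (`det₀ α = w σ(w) det₀ β`, norms are a group).  Pure algebra, no valuation; the KERNEL criterion is ★ K5 HEAD
`ite_isNormFromE_detZero_eq_one_iff`. [cite: Rogawski1990, §3.13 Prop. 3.13.1 p. 38; §3.11 p. 35] -/
theorem isNormFromE_detZero_iff_of_rel {F : Type} [Field F] [Algebra F E] (σ : E ≃ₐ[F] E) (h2 : (2 : E) ≠ 0) {z h α β : GL (Fin 3) E}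
    (hz : z ∈ fixedScalarSubgroup (σ : E →+* E)) (hh : h ∈ HTildePoints E) (hβ : β ∈ HTildePoints E)
    (hrel : z * α = h * β * (UnitaryGroup.qsInvolution (σ : E →+* E) h)⁻¹) :
    IsNormFromE F E σ (detZero E α) ↔ IsNormFromE F E σ (detZero E β) := by
  obtain ⟨w, hw, hαβ⟩ := detZero_eq_norm_mul_detZero_of_rel (σ : E →+* E) h2 hz hh hβ hrel
  rw [hαβ]
  exact isNormFromE_norm_mul_iff σ hw _

end Algebra

/-! ## §2 Signs `κ̃(x) = (ord_w x).negOnePow` in K3's `Valued K ℤᵐ⁰` frame -/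

section Sign

variable {K : Type} [Field K] [Valued K ℤᵐ⁰] (σ : K →+* K)

omit σ in
/-- **`κ̃` is multiplicative on `K^×`**: `(log v (x·y)).negOnePow = (log v x).negOnePow · (log v y).negOnePow` for `x, y ≠ 0`. [folklore] -/
private theorem negOnePow_log_mul_of_ne_zero {x y : K} (hx : x ≠ 0) (hy : y ≠ 0) :
    (WithZero.log (Valued.v (x * y))).negOnePow = (WithZero.log (Valued.v x)).negOnePow * (WithZero.log (Valued.v y)).negOnePow := by
  rw [map_mul, WithZero.log_mul ((Valuation.ne_zero_iff _).2 hx) ((Valuation.ne_zero_iff _).2 hy), Int.negOnePow_add]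

omit σ in
/-- **Squares and norms die under `κ̃`**: if `v a = v b` (`b ≠ 0`) then `(log v (a·b·x)).negOnePow = (log v x).negOnePow` (for `x = 0` both sides read
`log v 0`). [folklore] -/
private theorem negOnePow_log_mul_mul_of_valuation_eq {a b : K} (hab : Valued.v a = Valued.v b) (hb : b ≠ 0) (x : K) :
    (WithZero.log (Valued.v (a * b * x))).negOnePow = (WithZero.log (Valued.v x)).negOnePow := by
  by_cases hx : x = 0
  · rw [hx, mul_zero]
  have hvb : Valued.v b ≠ 0 := (Valuation.ne_zero_iff _).2 hb
  have ha : a ≠ 0 := (Valuation.ne_zero_iff Valued.v).1 (by rw [hab]; exact hvb)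
  rw [negOnePow_log_mul_of_ne_zero (mul_ne_zero ha hb) hx, map_mul, WithZero.log_mul (by rw [hab]; exact hvb) hvb, hab, ← two_mul,
    Int.negOnePow_two_mul, one_mul]

/-- **K6 §2 (K6.2) — `κ̃ ∘ det₀` IS MULTIPLICATIVE ON `H̃`**: `κ̃(det₀(αβ)) = κ̃(det₀ α)·κ̃(det₀ β)` for `α, β ∈ H̃` (char `≠ 2`; `det₀` multiplicative,
`det₀ ≠ 0` on `H̃` ★ K5). [cite: Rogawski1990, §3.13 p. 38; §4.10 p. 57] -/
theorem negOnePow_log_detZero_mul (h2 : (2 : K) ≠ 0) {α β : GL (Fin 3) K} (hα : α ∈ HTildePoints K) (hβ : β ∈ HTildePoints K) :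
    (WithZero.log (Valued.v (detZero K (α * β)))).negOnePow =
      (WithZero.log (Valued.v (detZero K α))).negOnePow * (WithZero.log (Valued.v (detZero K β))).negOnePow := by
  rw [detZero_mul_of_mem_HTildePoints h2 hα,
    negOnePow_log_mul_of_ne_zero (detZero_ne_zero_of_mem_HTildePoints h2 hα) (detZero_ne_zero_of_mem_HTildePoints h2 hβ)]

/-- **K6 §2 (K6.3) — ε-COBOUNDARIES DIE**: for `h ∈ H̃` (char `≠ 2`, `σ` isometric), `κ̃(det₀(h·Θ_σ(h)⁻¹)) = 1` —
`det₀(h Θ_σ(h)⁻¹) = det₀ h · σ(det₀ h)` has even valuation. [cite: Rogawski1990, §3.11 p. 35; §3.13 Prop. 3.13.1 p. 38] -/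
theorem negOnePow_log_detZero_mul_inv_qsInvolution (h2 : (2 : K) ≠ 0) (hvσ : ∀ a, Valued.v (σ a) = Valued.v a) {h : GL (Fin 3) K}
    (hh : h ∈ HTildePoints K) :
    (WithZero.log (Valued.v (detZero K (h * (UnitaryGroup.qsInvolution σ h)⁻¹)))).negOnePow = 1 := by
  have hh0 : detZero K h ≠ 0 := detZero_ne_zero_of_mem_HTildePoints h2 hh
  rw [detZero_mul_of_mem_HTildePoints h2 hh, detZero_inv_qsInvolution, ← mul_one (detZero K h * σ (detZero K h)),
    negOnePow_log_mul_mul_of_valuation_eq (hvσ _).symm ((map_ne_zero σ).2 hh0), map_one, WithZero.log_one, Int.negOnePow_zero]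

/-- **K6 §2 (K6.4) — SCALARS DIE**: for `z ∈ F^× ⊂ Z̃`, `κ̃(det₀(z·α)) = κ̃(det₀ α)` (`det₀(z·α) = c²·det₀ α`; unconditional in `α`).
[cite: Rogawski1990, §3.11 p. 35 («modulo multiplication by `F*`»)] -/
theorem negOnePow_log_detZero_fixedScalar_mul {z : GL (Fin 3) K} (hz : z ∈ fixedScalarSubgroup σ) (α : GL (Fin 3) K) :
    (WithZero.log (Valued.v (detZero K (z * α)))).negOnePow = (WithZero.log (Valued.v (detZero K α))).negOnePow := by
  obtain ⟨c, hc0, -, hzα⟩ := detZero_mul_of_mem_fixedScalarSubgroup σ hz α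
  rw [hzα, pow_two, negOnePow_log_mul_mul_of_valuation_eq rfl hc0]

/-- **K6 HEAD (K6.5) — `κ̃` IS A CLASS FUNCTION ON `𝔇 = cocycles ∕ (F^× · ε-coboundaries)`**: if `z·α = h·β·Θ_σ(h)⁻¹` with `z ∈ F^×` and
`h, β ∈ H̃` (char `≠ 2`, `σ` isometric), then `κ̃(det₀ α) = κ̃(det₀ β)` — `det₀ α = w σ(w) det₀ β` (§1) and norms have even valuation.  With §2 (K6.2)
`κ̃ ∘ det₀` is a CHARACTER of the commuting cocycles, constant on classes; its KERNEL is the `H`-image by ★ K5 HEAD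
`negOnePow_log_detZero_eq_one_iff_qsInvolution` (PROP. 3.13.1).  No `γ`, no cocycle hypothesis and no `Commute h γ` enter this statement; consumers
obtain `β ∈ H̃` from ★ K5 `mem_HTildePoints_of_commute`. [cite: Rogawski1990, §3.13 Prop. 3.13.1 p. 38; §3.11 p. 35; §4.10 p. 57] -/
theorem negOnePow_log_detZero_eq_of_rel (h2 : (2 : K) ≠ 0) (hvσ : ∀ a, Valued.v (σ a) = Valued.v a) {z h α β : GL (Fin 3) K}
    (hz : z ∈ fixedScalarSubgroup σ) (hh : h ∈ HTildePoints K) (hβ : β ∈ HTildePoints K)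
    (hrel : z * α = h * β * (UnitaryGroup.qsInvolution σ h)⁻¹) :
    (WithZero.log (Valued.v (detZero K α))).negOnePow = (WithZero.log (Valued.v (detZero K β))).negOnePow := by
  obtain ⟨w, hw, hαβ⟩ := detZero_eq_norm_mul_detZero_of_rel σ h2 hz hh hβ hrel
  rw [hαβ, negOnePow_log_mul_mul_of_valuation_eq (hvσ _).symm ((map_ne_zero σ).2 hw)]

end Sign

end Summit.HodgeConjecture.HodgeConjecture.R90.S6

end
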